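import Literature.Topology.FourManifolds.GompfFramedTwistTransport
import Literature.Topology.FourManifolds.CappellShanesonDeltaMove
import HarnessLib

/-!
# The shear model of a straightened Cappell–Shaneson monodromy: an explicit `Straightening`

Second infrastructure file for the framed form of Gompf's Theorem 2.1
(`Literature.Topology.FourManifolds.gompf2010_framedTwist`; R. Gompf, *More Cappell–Shaneson
spheres are standard*, Algebr. Geom. Topol. 10 (2010)). `GompfFramedTwistTransport.lean` proved
that a *straightening with exactly linear germs* (`Straightening A`) identifies the framed sphere
`gompfSphere A γ` with the product-framed surgery of the straightened mapping torus. This file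
constructs the basic example of such a straightening **by a closed formula**, for the unipotent
shear
`Λ = !![1, 0, 0; 0, 1, 0; 1, 0, 1]` (`(z₁, z₂, z₃) ↦ (z₁, z₂, z₁ z₃)` on `T³`, the linear part of a
Dehn twist of `T³` along the tori `{z₂ = const}`):

* `Literature.Topology.FourManifolds.sawArg`, `Literature.Topology.FourManifolds.nearBump` —
  a smooth "saw-tooth argument" `z ↦ arg z` with the branch cut moved into `(1, 2)` (minus the
  staircase `dehnProfileCircle 1 2` of `CappellShanesonDeltaMove.lean`) and a smooth bump of the
  circle equal to `1` where `re z ≥ cos 1`;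
* `Literature.Topology.FourManifolds.shearFactor t z₁ z₂ = exp (-i t χ(z₂) saw(z₁))` and the
  **shear diffeotopy** `Literature.Topology.FourManifolds.shearDiffeotopy`:
  `F_t (z₁, z₂, z₃) = (z₁, z₂, z₃ · shearFactor t z₁ z₂)` — based at `1`, preserving the first two
  coordinates, commuting with the rotations of the third, and *exactly linear* in exponential
  coordinates on the cube `|vᵢ| < 1`: `F_t (expT v) = expT (v₀, v₁, v₂ - t v₀)`
  (`shearDiffeotopy_expT`);
* `Literature.Topology.FourManifolds.modelShear : SL(3, ℤ)` (the matrix `Λ`) and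
  **`Literature.Topology.FourManifolds.modelStraightening : Straightening modelShear`**, whose
  straightened monodromy `𝔏 = Λ ∘ F₁ : (z₁, z₂, z₃) ↦ (z₁, z₂, z₃ z₁ e^{-i χ(z₂) saw(z₁)})`
  (`coe_modelMonodromy`) is the identity near `1`, equal to `Λ` off the support of the bump, and
  still preserves `z₁`, `z₂` and commutes with the rotations of `z₃` — so that its mapping torus is
  a principal circle bundle over the 3-torus of `(z₁, z₂, s)` (the "shear model" in which Gompf's
  fishtail neighbourhood of Theorem 2.1 becomes explicit: the punctured torus of his proof is a
  section of this bundle);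
* `Literature.Topology.FourManifolds.modelSphere` — the product-framed surgery of that mapping torus,
  and `Literature.Topology.FourManifolds.nonempty_diffeomorph_gompfSphere_modelShear_modelSphere`:
  `gompfSphere Λ γ ≃ₘ modelSphere` for `γ` in the straightening class of
  `modelStraightening.path` (an instance of the transport theorem).

Everything here is proved; no named facts are introduced.

## References

* R. E. Gompf, *More Cappell–Shaneson spheres are standard*, Algebr. Geom. Topol. 10 (2010)
  1665–1681: §2 ¶1 (`φ` the identity near `p`), §3 ¶1 ("straightening the corresponding linear
  diffeomorphism of `T³` to the identity near `0`"), §4 Def. 4.1 and ¶2. [GompfAGT2010]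
-/

open scoped Manifold ContDiff Topology Real
open Set Function Metric Filter Complex

noncomputable section

namespace Literature.Topology.FourManifolds

/-- Local notation: `𝔼 n` is the model Euclidean space `EuclideanSpace ℝ (Fin n)`. -/
local notation "𝔼 " n:arg => EuclideanSpace ℝ (Fin n)

/-- Local notation: the model with corners `𝓣 = (𝓡 1).prod ((𝓡 1).prod (𝓡 1))` of `ThreeTorus`. -/
local notation "𝓣" =>
  (ModelWithCorners.prod (𝓡 1) (ModelWithCorners.prod (𝓡 1) (𝓡 1)))

attribute [local instance] finrank_real_complex_fact'

/-! ### Two smooth functions on the circle -/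

section CircleFunctions

/-- **The saw-tooth argument**: `saw z = arg z - 2π S((arg z - 1)/(2 - 1))` — equal to `arg z` when
`arg z ≤ 1`, to `arg z - 2π` when `arg z ≥ 2`, smooth on the whole circle (the branch cut of `arg`
is moved into the arc `1 < arg z < 2`); minus the Dehn profile `dehnProfileCircle 1 2`. [folklore] -/
def sawArg (z : Circle) : ℝ := -dehnProfileCircle 1 2 z

/-- The saw-tooth argument is smooth. [folklore] -/
theorem contMDiff_sawArg : ContMDiff (𝓡 1) 𝓘(ℝ, ℝ) ∞ sawArg :=
  (contMDiff_dehnProfileCircle one_pos one_lt_two (by linarith [Real.pi_gt_three])).neg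

/-- **On the arc `arg z ≤ 1` the saw-tooth argument is the argument**: for `θ ∈ (-π, 1]`,
`saw (e^{iθ}) = θ`. [folklore] -/
theorem sawArg_exp {θ : ℝ} (h1 : -π < θ) (h2 : θ ≤ 1) : sawArg (Circle.exp θ) = θ := by
  have hπ := Real.pi_gt_three
  have h := gompfLift_eq_zero (a := 1) (b := 2) one_lt_two (by linarith) h1 h2
  rw [gompfLift] at h
  rw [sawArg]
  linarith

/-- `saw 1 = 0`. [folklore] -/
@[simp] theorem sawArg_one : sawArg 1 = 0 := by
  have h := sawArg_exp (θ := 0) (by linarith [Real.pi_pos]) (by norm_num)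
  rwa [Circle.exp_zero] at h

/-- **A bump of the circle around `1`**: `χ z = S (re z / cos 1)` with `S` the smooth transition —
`χ z = 1` when `re z ≥ cos 1` (in particular when `|arg z| ≤ 1`), `χ z = 0` when `re z ≤ 0`. [folklore] -/
def nearBump (z : Circle) : ℝ := Real.smoothTransition ((z : ℂ).re / Real.cos 1)

/-- `0 < cos 1`. [folklore] -/
theorem cos_one_pos' : 0 < Real.cos 1 :=
  Real.cos_pos_of_mem_Ioo ⟨by linarith [Real.pi_pos], by linarith [Real.pi_gt_three]⟩

/-- The bump is smooth. [folklore] -/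
theorem contMDiff_nearBump : ContMDiff (𝓡 1) 𝓘(ℝ, ℝ) ∞ nearBump := by
  have h1 : ContMDiff (𝓡 1) 𝓘(ℝ, ℝ) ∞ fun z : Circle ↦ (z : ℂ).re :=
    (Complex.reCLM.contDiff (n := ∞)).comp_contMDiff contMDiff_coe_circle
  have h2 : ContDiff ℝ ∞ fun x : ℝ ↦ Real.smoothTransition (x / Real.cos 1) :=
    Real.smoothTransition.contDiff.comp (contDiff_id.div_const _)
  exact h2.comp_contMDiff h1

/-- `χ z = 1` when `re z ≥ cos 1`. [folklore] -/
theorem nearBump_eq_one {z : Circle} (hz : Real.cos 1 ≤ (z : ℂ).re) : nearBump z = 1 :=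
  Real.smoothTransition.one_of_one_le ((one_le_div cos_one_pos').2 hz)

/-- `χ (e^{iθ}) = 1` for `|θ| ≤ 1`. [folklore] -/
theorem nearBump_exp {θ : ℝ} (hθ : |θ| ≤ 1) : nearBump (Circle.exp θ) = 1 := by
  refine nearBump_eq_one ?_
  rw [Circle.coe_exp, Complex.exp_ofReal_mul_I_re]
  have h1 : Real.cos θ = Real.cos |θ| := (Real.cos_abs θ).symm
  rw [h1]
  exact Real.cos_le_cos_of_nonneg_of_le_pi (abs_nonneg θ) (by linarith [Real.pi_gt_three]) hθ

/-- `χ 1 = 1`. [folklore] -/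
@[simp] theorem nearBump_one : nearBump 1 = 1 := by
  have h := nearBump_exp (θ := 0) (by norm_num)
  rwa [Circle.exp_zero] at h

/-- `χ z = 0` when `re z ≤ 0`. [folklore] -/
theorem nearBump_eq_zero {z : Circle} (hz : (z : ℂ).re ≤ 0) : nearBump z = 0 :=
  Real.smoothTransition.zero_of_nonpos (div_nonpos_of_nonpos_of_nonneg hz cos_one_pos'.le)

end CircleFunctions

/-! ### The shear diffeotopy of `T³` -/

section Shear

/-- **The shear factor** `e^{-i t χ(z₂) saw(z₁)} ∈ 𝕊¹`. [folklore] -/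
def shearFactor (t : ℝ) (z₁ z₂ : Circle) : Circle := Circle.exp (-(t * nearBump z₂ * sawArg z₁))

/-- The shear factor is jointly smooth in `(t, z₁, z₂)`. [folklore] -/
theorem contMDiff_shearFactor : ContMDiff (𝓘(ℝ, ℝ).prod ((𝓡 1).prod (𝓡 1))) (𝓡 1) ∞
    fun p : ℝ × (Circle × Circle) ↦ shearFactor p.1 p.2.1 p.2.2 := by
  unfold shearFactor
  refine contMDiff_circleExp.comp ?_
  refine ContMDiff.neg ?_
  exact ((contMDiff_fst.mul (contMDiff_nearBump.comp (contMDiff_snd.comp contMDiff_snd))).mul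
    (contMDiff_sawArg.comp (contMDiff_fst.comp contMDiff_snd)))

/-- At time `0` the shear factor is `1`. [folklore] -/
@[simp] theorem shearFactor_zero (z₁ z₂ : Circle) : shearFactor 0 z₁ z₂ = 1 := by
  simp [shearFactor]

/-- At the base point the shear factor is `1`. [folklore] -/
@[simp] theorem shearFactor_one_one (t : ℝ) : shearFactor t 1 1 = 1 := by
  simp [shearFactor]

/-- **The shear factor in exponential coordinates**: for `|θ₁|, |θ₂| < 1`,
`shearFactor t (e^{iθ₁}) (e^{iθ₂}) = e^{-i t θ₁}`. [folklore] -/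
theorem shearFactor_exp (t : ℝ) {θ₁ θ₂ : ℝ} (h₁ : |θ₁| < 1) (h₂ : |θ₂| < 1) :
    shearFactor t (Circle.exp θ₁) (Circle.exp θ₂) = Circle.exp (-(t * θ₁)) := by
  have hπ := Real.pi_gt_three
  rw [shearFactor, nearBump_exp h₂.le, mul_one,
    sawArg_exp (by linarith [(abs_lt.1 h₁).1]) (abs_lt.1 h₁).2.le]

/-- **The stages of the shear diffeotopy**: `F_t (z₁, z₂, z₃) = (z₁, z₂, z₃ · shearFactor t z₁ z₂)`. [folklore] -/
def shearStage (t : ℝ) (z : ThreeTorus) : ThreeTorus := (z.1, z.2.1, z.2.2 * shearFactor t z.1 z.2.1)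

/-- **The inverse stages**: divide the third coordinate by the shear factor. [folklore] -/
def shearStageInv (t : ℝ) (z : ThreeTorus) : ThreeTorus :=
  (z.1, z.2.1, z.2.2 * (shearFactor t z.1 z.2.1)⁻¹)

/-- The stages are jointly smooth. [folklore] -/
theorem contMDiff_shearStage_uncurry :
    ContMDiff (𝓘(ℝ, ℝ).prod 𝓣) 𝓣 ∞ (uncurry shearStage) := by
  have hf : ContMDiff (𝓘(ℝ, ℝ).prod 𝓣) (𝓡 1) ∞
      fun p : ℝ × ThreeTorus ↦ shearFactor p.1 p.2.1 p.2.2.1 :=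
    contMDiff_shearFactor.comp (contMDiff_fst.prodMk ((contMDiff_fst.comp contMDiff_snd).prodMk
      (contMDiff_fst.comp (contMDiff_snd.comp contMDiff_snd))))
  exact (contMDiff_fst.comp contMDiff_snd).prodMk
    ((contMDiff_fst.comp (contMDiff_snd.comp contMDiff_snd)).prodMk
      ((contMDiff_snd.comp (contMDiff_snd.comp contMDiff_snd)).mul hf))

/-- The inverse stages are jointly smooth. [folklore] -/
theorem contMDiff_shearStageInv_uncurry :
    ContMDiff (𝓘(ℝ, ℝ).prod 𝓣) 𝓣 ∞ (uncurry shearStageInv) := by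
  have hf : ContMDiff (𝓘(ℝ, ℝ).prod 𝓣) (𝓡 1) ∞
      fun p : ℝ × ThreeTorus ↦ shearFactor p.1 p.2.1 p.2.2.1 :=
    contMDiff_shearFactor.comp (contMDiff_fst.prodMk ((contMDiff_fst.comp contMDiff_snd).prodMk
      (contMDiff_fst.comp (contMDiff_snd.comp contMDiff_snd))))
  exact (contMDiff_fst.comp contMDiff_snd).prodMk
    ((contMDiff_fst.comp (contMDiff_snd.comp contMDiff_snd)).prodMk
      ((contMDiff_snd.comp (contMDiff_snd.comp contMDiff_snd)).mul hf.inv))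

/-- **The shear diffeotopy** `F_t (z₁, z₂, z₃) = (z₁, z₂, z₃ e^{-i t χ(z₂) saw(z₁)})` of `T³`:
from the identity to the compactly-supported-in-a-slab straightening of the shear `Λ⁻¹` near `1`
(Gompf 2010, §3 ¶1: "straightening the corresponding linear diffeomorphism of `T³` to the identity
near `0`", here for the shear by an explicit formula). [cite: GompfAGT2010, §3 ¶1 (straightening the linear diffeomorphism near 0)] -/
def shearDiffeotopy : Diffeotopy 𝓣 ThreeTorus :=
  Diffeotopy.mk' 𝓣 shearStage shearStageInv contMDiff_shearStage_uncurry
    contMDiff_shearStageInv_uncurry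
    (fun t z ↦ by simp [shearStage, shearStageInv, mul_assoc])
    (fun t z ↦ by simp [shearStage, shearStageInv, mul_assoc])
    (by funext z; simp [shearStage])

/-- The stages (definitional). [folklore] -/
@[simp] theorem shearDiffeotopy_toFun (t : ℝ) (z : ThreeTorus) :
    shearDiffeotopy.toFun t z = (z.1, z.2.1, z.2.2 * shearFactor t z.1 z.2.1) := rfl

/-- The inverse stages (definitional). [folklore] -/
@[simp] theorem shearDiffeotopy_invFun (t : ℝ) (z : ThreeTorus) :
    shearDiffeotopy.invFun t z = (z.1, z.2.1, z.2.2 * (shearFactor t z.1 z.2.1)⁻¹) := rfl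

/-- The shear diffeotopy is based at `1`. [folklore] -/
theorem shearDiffeotopy_apply_one (t : ℝ) : shearDiffeotopy.toFun t 1 = 1 := by
  simp

/-- **The stages preserve the first two coordinates.** [folklore] -/
theorem shearDiffeotopy_fst (t : ℝ) (z : ThreeTorus) : (shearDiffeotopy.toFun t z).1 = z.1 := rfl

/-- The stages preserve the second coordinate. [folklore] -/
theorem shearDiffeotopy_snd_fst (t : ℝ) (z : ThreeTorus) : (shearDiffeotopy.toFun t z).2.1 = z.2.1 := rfl

/-- **The stages commute with the rotations of the third coordinate** (they are multiplications of
the third coordinate by a function of the first two). [folklore] -/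
theorem shearDiffeotopy_rotate (t : ℝ) (c : Circle) (z : ThreeTorus) :
    shearDiffeotopy.toFun t (z.1, z.2.1, c * z.2.2) = ((shearDiffeotopy.toFun t z).1,
      (shearDiffeotopy.toFun t z).2.1, c * (shearDiffeotopy.toFun t z).2.2) := by
  simp [mul_assoc]

/-! ### Exact linearity on the cube `|vᵢ| < 1` -/

/-- **The linear parts** `G_t = !![1, 0, 0; 0, 1, 0; -t, 0, 1]` of the shear stages at `1`. [folklore] -/
def shearLin (t : ℝ) : Matrix (Fin 3) (Fin 3) ℝ := !![1, 0, 0; 0, 1, 0; -t, 0, 1]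

/-- `G_t G_{-t} = 1`. [folklore] -/
theorem shearLin_mul_neg (t : ℝ) : shearLin t * shearLin (-t) = 1 := by
  ext i j
  fin_cases i <;> fin_cases j <;> simp [shearLin, Matrix.mul_apply, Fin.sum_univ_three]

/-- `G_0 = 1`. [folklore] -/
@[simp] theorem shearLin_zero : shearLin 0 = 1 := by
  ext i j
  fin_cases i <;> fin_cases j <;> simp [shearLin]

/-- The nilpotent direction `N = -E₂₀` of the shear: `G_t = 1 + t N`. [folklore] -/
def shearNil : Matrix (Fin 3) (Fin 3) ℝ := !![0, 0, 0; 0, 0, 0; -1, 0, 0]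

/-- `G_t = 1 + t N`. [folklore] -/
theorem shearLin_eq (t : ℝ) : shearLin t = 1 + t • shearNil := by
  ext i j
  fin_cases i <;> fin_cases j <;> simp [shearLin, shearNil]

/-- The entries of `G_t` are smooth (affine) in `t`. [folklore] -/
theorem contDiff_shearLin_apply (i j : Fin 3) : ContDiff ℝ ∞ fun t ↦ shearLin t i j := by
  simp_rw [shearLin_eq, Matrix.add_apply, Matrix.smul_apply, smul_eq_mul]
  exact contDiff_const.add (contDiff_id.mul contDiff_const)

/-- The coordinates of `G_t v`: `(v₀, v₁, v₂ - t v₀)`. [folklore] -/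
theorem mulVecE_shearLin (t : ℝ) (v : 𝔼 3) :
    mulVecE (shearLin t) v 0 = v 0 ∧ mulVecE (shearLin t) v 1 = v 1 ∧
      mulVecE (shearLin t) v 2 = v 2 - t * v 0 := by
  simp only [mulVecE_apply, shearLin, Fin.sum_univ_three, Matrix.of_apply, Matrix.cons_val',
    Matrix.cons_val_zero, Matrix.cons_val_one, Matrix.cons_val_two, Matrix.cons_val_fin_one,
    Matrix.empty_val', Matrix.head_cons, Matrix.tail_cons, Matrix.head_fin_const]
  refine ⟨by ring, by ring, by ring⟩

/-- **Exact linearity of the stages on the cube**: `F_t (expT v) = expT (G_t v)` for `|vᵢ| < 1`. [cite: GompfAGT2010, §3 ¶1 (straightening the linear diffeomorphism near 0)] -/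
theorem shearDiffeotopy_expT (t : ℝ) (v : 𝔼 3) (hv : ∀ i, |v i| < 1) :
    shearDiffeotopy.toFun t (expT v) = expT (mulVecE (shearLin t) v) := by
  obtain ⟨h0, h1, h2⟩ := mulVecE_shearLin t v
  rw [shearDiffeotopy_toFun]
  show (Circle.exp (v 0), Circle.exp (v 1), Circle.exp (v 2) * shearFactor t (Circle.exp (v 0))
    (Circle.exp (v 1))) = (Circle.exp _, Circle.exp _, Circle.exp _)
  rw [h0, h1, h2, shearFactor_exp t (hv 0) (hv 1), ← Circle.exp_add, ← sub_eq_add_neg]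

/-- **Exact linearity of the inverse stages on the cube**: `F_t⁻¹ (expT v) = expT (G_{-t} v)`. [folklore] -/
theorem shearDiffeotopy_invFun_expT (t : ℝ) (v : 𝔼 3) (hv : ∀ i, |v i| < 1) :
    shearDiffeotopy.invFun t (expT v) = expT (mulVecE (shearLin (-t)) v) := by
  obtain ⟨h0, h1, h2⟩ := mulVecE_shearLin (-t) v
  rw [shearDiffeotopy_invFun]
  show (Circle.exp (v 0), Circle.exp (v 1), Circle.exp (v 2) * (shearFactor t (Circle.exp (v 0))
    (Circle.exp (v 1)))⁻¹) = (Circle.exp _, Circle.exp _, Circle.exp _)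
  rw [h0, h1, h2, shearFactor_exp t (hv 0) (hv 1), ← Circle.exp_neg, ← Circle.exp_add, neg_neg,
    neg_mul, sub_neg_eq_add]

end Shear

/-! ### The model shear `Λ ∈ SL(3, ℤ)` and its straightening -/

section Model

/-- **The model shear** `Λ = !![1, 0, 0; 0, 1, 0; 1, 0, 1]`: `(z₁, z₂, z₃) ↦ (z₁, z₂, z₁ z₃)` on `T³`,
the linear part of a Dehn twist along the tori `{z₂ = const}` in the direction of the third
coordinate circle (in the coordinates of the blueprint: `(n, y, ℓ) ↦ (n, y, ℓ + n)`). [cite: GompfAGT2010, §3 (the matrix Δ)] -/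
def modelShear : Matrix.SpecialLinearGroup (Fin 3) ℤ :=
  ⟨!![1, 0, 0; 0, 1, 0; 1, 0, 1], by decide⟩

/-- The real matrix of `Λ⁻¹` is `G_1 = !![1, 0, 0; 0, 1, 0; -1, 0, 1]`. [folklore] -/
theorem slRealMatrix_modelShear_inv : slRealMatrix modelShear⁻¹ = shearLin 1 := by
  have h : ((modelShear⁻¹ : Matrix.SpecialLinearGroup (Fin 3) ℤ) : Matrix (Fin 3) (Fin 3) ℤ) =
      !![1, 0, 0; 0, 1, 0; -1, 0, 1] := by
    rw [Matrix.SpecialLinearGroup.coe_inv]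
    decide
  ext i j
  rw [slRealMatrix, h]
  fin_cases i <;> fin_cases j <;> simp [shearLin]

/-- The real matrix of `Λ` is `G_{-1}`. [folklore] -/
theorem slRealMatrix_modelShear : slRealMatrix modelShear = shearLin (-1) := by
  ext i j
  fin_cases i <;> fin_cases j <;> simp [slRealMatrix, modelShear, shearLin]

/-- **The model straightening**: the shear diffeotopy straightens `Λ` with exactly linear germs
`G_t` on the cube `|vᵢ| < 1` (`Straightening` of `GompfFramedTwistTransport.lean`). [cite: GompfAGT2010, Def. 4.1 and §4 ¶2 (X^σ depends only on the straightening class σ)] -/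
def modelStraightening : Straightening modelShear where
  D := shearDiffeotopy
  based := shearDiffeotopy_apply_one
  G := shearLin
  Ginv t := shearLin (-t)
  contDiff_G := contDiff_shearLin_apply
  contDiff_Ginv i j := (contDiff_shearLin_apply i j).comp contDiff_neg
  G_mul_Ginv := shearLin_mul_neg
  Ginv_mul_G t := by simpa using shearLin_mul_neg (-t)
  G_zero := shearLin_zero
  G_one := slRealMatrix_modelShear_inv.symm
  R := 1
  R_pos := one_pos
  toFun_expT := shearDiffeotopy_expT
  invFun_expT := shearDiffeotopy_invFun_expT

/-- **The straightened shear** `𝔏 = Λ ∘ F₁`, the monodromy of the shear model. [cite: GompfAGT2010, §2 (definition of X_φ and X_φ^ε)] -/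
abbrev modelMonodromy : ThreeTorus ≃ₘ⟮𝓣, 𝓣⟯ ThreeTorus := modelStraightening.monodromy

/-- **The formula of the straightened shear**: `𝔏 (z₁, z₂, z₃) = (z₁, z₂, z₃ z₁ e^{-i χ(z₂) saw(z₁)})`. [folklore] -/
theorem coe_modelMonodromy (z : ThreeTorus) :
    modelMonodromy z = (z.1, z.2.1, z.2.2 * z.1 * shearFactor 1 z.1 z.2.1) := by
  rw [modelMonodromy, Straightening.monodromy, Diffeomorph.coe_trans, comp_apply, Diffeotopy.coe_stage,
    coe_torusDiffeomorph]
  show torusMap (modelShear : Matrix (Fin 3) (Fin 3) ℤ) (shearDiffeotopy.toFun 1 z) = _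
  rw [shearDiffeotopy_toFun]
  refine torusCoord_injective (funext fun i ↦ ?_)
  rw [torusCoord_torusMap]
  fin_cases i <;> simp [torusMonomial, torusCoord, modelShear, Fin.prod_univ_three, mul_assoc, mul_comm]

/-- **`𝔏` preserves the first coordinate.** [folklore] -/
theorem modelMonodromy_fst (z : ThreeTorus) : (modelMonodromy z).1 = z.1 := by
  rw [coe_modelMonodromy]

/-- **`𝔏` preserves the second coordinate.** [folklore] -/
theorem modelMonodromy_snd_fst (z : ThreeTorus) : (modelMonodromy z).2.1 = z.2.1 := by
  rw [coe_modelMonodromy]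

/-- **`𝔏` commutes with the rotations of the third coordinate**: its mapping torus is a principal
circle bundle over the 3-torus of `(z₁, z₂, s)`. [folklore] -/
theorem modelMonodromy_rotate (c : Circle) (z : ThreeTorus) :
    modelMonodromy (z.1, z.2.1, c * z.2.2) =
      ((modelMonodromy z).1, (modelMonodromy z).2.1, c * (modelMonodromy z).2.2) := by
  rw [coe_modelMonodromy, coe_modelMonodromy]
  simp only [mul_assoc]

/-- **`𝔏` is the identity on the cube `|vᵢ| < 1`** (in particular near `1`). [cite: GompfAGT2010, §2 (definition of X_φ and X_φ^ε)] -/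
theorem modelMonodromy_expT (v : 𝔼 3) (hv : ∀ i, |v i| < 1) : modelMonodromy (expT v) = expT v :=
  modelStraightening.monodromy_expT v hv

/-- **`𝔏` is the linear shear `Λ` off the support of the bump**: where `re z₂ ≤ 0`,
`𝔏 (z₁, z₂, z₃) = (z₁, z₂, z₁ z₃)`. [folklore] -/
theorem modelMonodromy_of_re_le {z : ThreeTorus} (hz : ((z.2.1 : Circle) : ℂ).re ≤ 0) :
    modelMonodromy z = (z.1, z.2.1, z.2.2 * z.1) := by
  rw [coe_modelMonodromy, shearFactor, nearBump_eq_zero hz]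
  simp

/-- **The shear model sphere**: the product-framed surgery of the mapping torus of `𝔏` along its
section circle (`Straightening.prodSphere`), Gompf's `X^0_𝔏`. [cite: GompfAGT2010, §2 (definition of X_φ and X_φ^ε)] -/
abbrev modelSphere : Type := modelStraightening.prodSphere

/-- **The framed Cappell–Shaneson spheres of the shear `Λ` in the straightening class of the model
are the shear model sphere** (`Straightening.nonempty_diffeomorph_gompfSphere_prodSphere_of_homotopic`). [cite: GompfAGT2010, §4 ¶2 (X^{τ·σ}_ψ = X^σ_φ)] -/
theorem nonempty_diffeomorph_gompfSphere_modelShear_modelSphere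
    (γ : SmoothMatrixPath (slRealMatrix modelShear))
    (hγ : γ.toPath.Homotopic modelStraightening.path.toPath) :
    Nonempty (gompfSphere modelShear γ ≃ₘ⟮𝓡 4, 𝓡 4⟯ modelSphere) :=
  modelStraightening.nonempty_diffeomorph_gompfSphere_prodSphere_of_homotopic γ hγ

end Model

end Literature.Topology.FourManifolds
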